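import Literature.NumberTheory.GaloisCohomology.Howard2004.PiAdicRefinement
import Literature.NumberTheory.GaloisCohomology.Howard2004.TowerReindex
import Literature.NumberTheory.GaloisCohomology.Howard2004.LevelRaisingNoFixedVectorProofs
import HarnessLib

/-!
# Howard 2004, §1.6 with Rem. 1.3.1: the `π`-adic refinement of a `DVRSetting` — the datum, the refined
# tower `i ↦ T/π^{i+1}T`, and the marked levels (definitions with bodies + proved identities)

B. Howard, *The Heegner point Kolyvagin system*, Compositio Math. **140** (2004) (arXiv:1202.6340).  In the
proof of Thm. 1.6.1 (arXiv Thm. 2.6.1, p. 11 L33 – p. 12 L55) Howard's tower is `T^{(k)} = T/𝔪^k T` for EVERY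
`k ≥ 1`, and the double induction of Lemma 1.6.4 (arXiv Lemma 2.6.4, p. 12 L3–27) walks down through
arbitrary exponents.  The tree's `DVRSetting` (`Howard2004/DVRKolyvaginBound`) carries a tower
`k ↦ T/𝔪^{e_k}` for ANY strictly increasing `e` (the D1 Eisenstein frames have `e_k = m(k+1)`), so the
exponents strictly between `e_k` and `e_{k+1}` are not levels («LEVEL-GAP», cell `pub/bsd-print-x9`,
x10b-p1-w7 g7 2026-08-29; LEAD ruling (β): prove Lemma 1.6.4 on FULL settings and REFINE a general one).

This file is brick (R1) of the refinement constructor (REFINE): from `S : DVRSetting …` with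
`hy : S.SatisfiesH` it builds

* §1 `AdicTower.redLE` — the two-index reductions `T^{(k')} ↠ T^{(k)}` (`k ≤ k'`) of any `AdicTower`
  (cast-free, by `Nat.leRec`), with `redLE_self/succ/trans/surjective/equivariant`;
* §2 on a `DVRSetting` with H.0–H.5: `ker redLE = 𝔪^{e_k} · T^{(k')}` (exact tower) and exact
  `π`-divisibility below the exponent (H.0), and the HOST `S.host hy i` = the least level `k` with `i ≤ e_k`;
* §3 **`DVRSetting.piRefinementDatum S hy : PiRefinementDatum K R N`** (x10b-p1-w6's two-index datum:
  `π := S.π`, `e := S.e`, reductions `redLE`, host as in §2) — so that `PiRefinementDatum.Level i = T/π^iT`,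
  `levelRep`, `map a b` (`×π^{b∸a}`), `map_mk_red`, `isQuotientBy_levelRep`, … of `Howard2004/PiAdicRefinement`
  are available for EVERY exponent `i`;
* §4 **`DVRSetting.refinedTower S hy : AdicTower K R (fun i ↦ Level (i+1))`** — the FULL tower
  `… ↠ T/π^{i+2} ↠ T/π^{i+1} ↠ …` (level `i` is `T/π^{i+1}`, exponents `i + 1`), reductions `map (i+2) (i+1)`;
  `refinedTower_redIter` identifies its iterated reductions with `map`;
* §5 the MARKED LEVELS: for `i = e_k` the host is `k` and `proj : T^{(k)} → Level i` is an `R`-linear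
  `Γ_K`-equivariant BIJECTION (`proj_bijective_of_eq_e`), compatible with the reductions
  (`proj_red_eq_map_proj`) — the letters `ι`, `hιb`, `hιe`, `hιred` of the (COFINAL) interface
  (HOME/p1/COFINAL-SPEC-x10b-p1-g11.md; x10b-p1-w7 g8 2026-08-29T04:48:27Z), with `σ k + 1 = e_k`.

Sequels (R2–R8) add the level rings `R/π^{i+1}`, the Selmer triples by propagation, the residual and
duality data, the level data and the Kolyvagin system of the refined setting.  Definitions with bodies and
theorems only: no named fact, no instance, no notation, no `sorry`.  No statement about elliptic curves is
made; `thm161_dvrKolyvaginBound` is NOT proved here; BSD is not proved by any of this.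
-/

set_option autoImplicit false

noncomputable section

open Function NumberField IsDedekindDomain Field
open scoped NumberField ContRepresentation Classical

namespace Literature.NumberTheory.GaloisCohomology.Howard2004

open Literature.NumberTheory.GaloisRepresentations
open Literature.NumberTheory.GaloisRepresentations.DiscreteGaloisModule

/-! ## §1 Two-index reductions of a tower -/

namespace AdicTower

variable {K : Type} [Field K] {R : Type} [CommRing R] [IsLocalRing R]
  {N : ℕ → Type} [∀ k, AddCommGroup (N k)] [∀ k, TopologicalSpace (N k)]
  [∀ k, DiscreteTopology (N k)] [∀ k, Module R (N k)]

/-- **The reduction `T^{(k')} ↠ T^{(k)}` for `k ≤ k'`** (`red_k ∘ ⋯ ∘ red_{k'-1}`), defined by recursion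
on the proof of `k ≤ k'` (no index casts). [cite: Howard2004HeegnerKolyvagin, §1.6 (arXiv p. 12, L29–33)] -/
def redLE (T : AdicTower K R N) {k k' : ℕ} (h : k ≤ k') : N k' →ₗ[R] N k :=
  Nat.leRec (motive := fun k' _ => N k' →ₗ[R] N k) LinearMap.id
    (fun k' _ (g : N k' →ₗ[R] N k) => g.comp (T.red k')) h

/-- `redLE` at `k ≤ k` is the identity. [cite: Howard2004HeegnerKolyvagin, §1.6 (arXiv p. 12, L29–33)] -/
@[simp] theorem redLE_self (T : AdicTower K R N) (k : ℕ) (x : N k) : T.redLE (le_refl k) x = x := by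
  have h : T.redLE (le_refl k) = LinearMap.id := Nat.leRec_self _ _
  rw [h, LinearMap.id_apply]

/-- `redLE (k ≤ k'+1) = redLE (k ≤ k') ∘ red_{k'}`. [cite: Howard2004HeegnerKolyvagin, §1.6 (arXiv p. 12, L29–33)] -/
theorem redLE_succ (T : AdicTower K R N) {k k' : ℕ} (h : k ≤ k') (x : N (k' + 1)) :
    T.redLE (Nat.le_succ_of_le h) x = T.redLE h (T.red k' x) := by
  have h' : T.redLE (Nat.le_succ_of_le h) = (T.redLE h).comp (T.red k') := Nat.leRec_succ _ _ h
  rw [h', LinearMap.comp_apply]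

/-- `redLE (k ≤ k+1) = red_k`. [cite: Howard2004HeegnerKolyvagin, §1.6 (arXiv p. 12, L29–33)] -/
@[simp] theorem redLE_succ_self (T : AdicTower K R N) (k : ℕ) (x : N (k + 1)) :
    T.redLE (Nat.le_succ k) x = T.red k x := by
  rw [redLE_succ T (le_refl k), redLE_self]

/-- Transitivity: `redLE (a ≤ c) = redLE (a ≤ b) ∘ redLE (b ≤ c)`. [cite: Howard2004HeegnerKolyvagin, §1.6 (arXiv p. 12, L29–33)] -/
theorem redLE_trans (T : AdicTower K R N) {a b c : ℕ} (h₁ : a ≤ b) (h₂ : b ≤ c) (x : N c) :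
    T.redLE (h₁.trans h₂) x = T.redLE h₁ (T.redLE h₂ x) := by
  induction c, h₂ using Nat.le_induction with
  | base => rw [redLE_self]
  | succ c h₂ ih => rw [redLE_succ T (h₁.trans h₂), redLE_succ T h₂, ih]

/-- The two-index reductions are onto. [cite: Howard2004HeegnerKolyvagin, §1.6 (arXiv p. 12, L29–33)] -/
theorem redLE_surjective (T : AdicTower K R N) {k k' : ℕ} (h : k ≤ k') : Surjective (T.redLE h) := by
  induction k', h using Nat.le_induction with
  | base => intro x; exact ⟨x, T.redLE_self k x⟩
  | succ k' h ih =>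
    intro x
    obtain ⟨y, rfl⟩ := ih x
    obtain ⟨z, rfl⟩ := T.red_surjective k' y
    exact ⟨z, T.redLE_succ h z⟩

/-- The two-index reductions are `Γ_K`-equivariant. [cite: Howard2004HeegnerKolyvagin, §1.6 (arXiv p. 12, L29–33)] -/
theorem redLE_equivariant (T : AdicTower K R N) {k k' : ℕ} (h : k ≤ k') (σ : absoluteGaloisGroup K)
    (x : N k') : T.redLE h (T.ρ k' σ x) = T.ρ k σ (T.redLE h x) := by
  induction k', h using Nat.le_induction with
  | base => rw [redLE_self, redLE_self]
  | succ k' h ih => rw [redLE_succ T h, redLE_succ T h, T.red_equivariant, ih]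

/-- `redLE (k ≤ k + d)` is the iterated reduction `redIter k d` of `TowerReindex`.
[cite: Howard2004HeegnerKolyvagin, §1.6 (arXiv p. 12, L29–33)] -/
theorem redLE_eq_redIter (T : AdicTower K R N) (k : ℕ) :
    ∀ (d : ℕ) (x : N (k + d)), T.redLE (Nat.le_add_right k d) x = T.redIter k d x
  | 0, x => T.redLE_self k x
  | d + 1, x => by
    rw [AdicTower.redIter_succ, ← redLE_eq_redIter T k d, ← T.redLE_succ (Nat.le_add_right k d) x]

/-- A submodule of the form `I · T^{(k')}` reduces ONTO `I · T^{(k)}`. [cite: Howard2004HeegnerKolyvagin, §1.6 (arXiv p. 12, L29–33)] -/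
theorem map_redLE_smul_top (T : AdicTower K R N) {k k' : ℕ} (h : k ≤ k') (I : Ideal R) :
    (I • (⊤ : Submodule R (N k'))).map (T.redLE h) = I • (⊤ : Submodule R (N k)) := by
  rw [Submodule.map_smul'', Submodule.map_top, LinearMap.range_eq_top.mpr (T.redLE_surjective h)]

end AdicTower

/-! ## §2 The exact tower of a `DVRSetting`: kernels of the two-index reductions, exact divisibility, hosts -/

namespace DVRSetting

variable {p : ℕ} [Fact p.Prime] {K : Type} [Field K] [NumberField K]
  {R : Type} [CommRing R] [IsDomain R] [IsDiscreteValuationRing R] [Algebra ℤ_[p] R]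
  {N : ℕ → Type} [∀ k, AddCommGroup (N k)] [∀ k, TopologicalSpace (N k)]
  [∀ k, DiscreteTopology (N k)] [∀ k, Module R (N k)]
  {Rk : ℕ → Type} [∀ k, CommRing (Rk k)] [∀ k, IsLocalRing (Rk k)] [∀ k, TopologicalSpace (Rk k)]
  [∀ k, DiscreteTopology (Rk k)] [∀ k, Algebra ℤ_[p] (Rk k)] [∀ k, Algebra R (Rk k)]
  [∀ k, Module (Rk k) (N k)] [∀ k, IsScalarTower R (Rk k) (N k)]
  {Nbar : Type} [AddCommGroup Nbar] [TopologicalSpace Nbar] [DiscreteTopology Nbar]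
  [∀ k, Module (Rk k) Nbar]
  {Nq : ℕ → Finset (HeightOneSpectrum (𝓞 K)) → Type} [∀ k n, AddCommGroup (Nq k n)]
  [∀ k n, TopologicalSpace (Nq k n)] [∀ k n, DiscreteTopology (Nq k n)]
  [∀ k n, Module (Rk k) (Nq k n)] [∀ k n, Module R (Nq k n)]
  [∀ k n, IsScalarTower R (Rk k) (Nq k n)]

/-- The uniformiser is non-zero (cf. `DVRSetting.π_ne_zero` of `DVRLevelRaisingInjectiveProofs`, not imported to
keep this file light). [cite: Howard2004HeegnerKolyvagin, §1.6 (arXiv p. 11, L13–14)] -/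
private theorem pi_ne_zero_aux (S : DVRSetting p K R N Rk Nbar Nq) (hy : S.SatisfiesH) : S.π ≠ 0 := fun h =>
  IsDiscreteValuationRing.not_a_field R (by rw [hy.unif, h, Ideal.span_singleton_eq_bot])

/-- **Exact tower: `ker (T^{(k')} ↠ T^{(k)}) = 𝔪^{e_k} · T^{(k')}`** for `k ≤ k'` (levelwise `ker red_j =
𝔪^{e_j} T^{(j+1)}`, `e` increasing, every level killed by its own power of `𝔪`).
[cite: Howard2004HeegnerKolyvagin, §1.6 (arXiv p. 11 L33–36: `T^{(k)} = T/𝔪^k T`)] -/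
theorem ker_redLE (S : DVRSetting p K R N Rk Nbar Nq) (hy : S.SatisfiesH) {k k' : ℕ} (h : k ≤ k') :
    LinearMap.ker (S.T.redLE h) = (IsLocalRing.maximalIdeal R ^ S.e k) • (⊤ : Submodule R (N k')) := by
  apply le_antisymm
  · induction k', h using Nat.le_induction with
    | base =>
      intro x hx
      rw [LinearMap.mem_ker, AdicTower.redLE_self] at hx
      rw [hx]
      exact Submodule.zero_mem _
    | succ k' h ih =>
      intro x hx
      rw [LinearMap.mem_ker, AdicTower.redLE_succ S.T h] at hx
      have h1 : S.T.red k' x ∈ (IsLocalRing.maximalIdeal R ^ S.e k) • (⊤ : Submodule R (N k')) :=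
        ih (LinearMap.mem_ker.mpr hx)
      rw [← S.T.map_redLE_smul_top (Nat.le_succ k'), Submodule.mem_map] at h1
      obtain ⟨y, hy1, hyx⟩ := h1
      rw [AdicTower.redLE_succ_self] at hyx
      have hker : x - y ∈ LinearMap.ker (S.T.red k') := by
        rw [LinearMap.mem_ker, map_sub, hyx, sub_self]
      rw [hy.ker_red k'] at hker
      have hle : (IsLocalRing.maximalIdeal R ^ S.e k') • (⊤ : Submodule R (N (k' + 1))) ≤
          (IsLocalRing.maximalIdeal R ^ S.e k) • ⊤ :=
        Submodule.smul_mono_left (Ideal.pow_le_pow_right (hy.e_strictMono.monotone h))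
      rw [← sub_add_cancel x y]
      exact Submodule.add_mem _ (hle hker) hy1
  · refine Submodule.smul_le.mpr fun r hr x _ => ?_
    rw [LinearMap.mem_ker, map_smul]
    exact hy.killed k r hr _

/-- **Exact `π`-divisibility below the exponent** on the level `T^{(k)}` (free of rank two over
`R_k = R/𝔪^{e_k}`, H.0): for `c + n ≤ e_k`, `π^n x ∈ π^{c+n} T^{(k)} ⇒ x ∈ π^c T^{(k)}`.
[cite: Howard2004HeegnerKolyvagin, Rem. 1.1.4 and H.0 (arXiv p. 5 L100–105, p. 7 L57)] -/
theorem smul_mem_cancel_level (S : DVRSetting p K R N Rk Nbar Nq) (hy : S.SatisfiesH) (k : ℕ) (x : N k)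
    (c n : ℕ) (hcn : c + n ≤ S.e k)
    (hx : S.π ^ n • x ∈ Ideal.span {S.π ^ (c + n)} • (⊤ : Submodule R (N k))) :
    x ∈ Ideal.span {S.π ^ c} • (⊤ : Submodule R (N k)) := by
  haveI := (hy.h0 k).1
  rw [Submodule.ideal_span_singleton_smul, Submodule.mem_smul_pointwise_iff_exists] at hx
  obtain ⟨y, -, hyx⟩ := hx
  have h0 : S.π ^ n • (x - S.π ^ c • y) = 0 := by
    rw [smul_sub, ← mul_smul, ← pow_add, Nat.add_comm, hyx, sub_self]
  have hker : RingHom.ker (algebraMap R (Rk k)) ≤ Ideal.span {S.π ^ S.e k} := by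
    rw [hy.ker_algebraMap, hy.unif, Ideal.span_singleton_pow]
  obtain ⟨v, hv⟩ := LevelRaising.exists_eq_pow_smul_of_pow_smul_eq_zero S.π (S.pi_ne_zero_aux hy)
    (S.e k) (hy.algebraMap_surjective k) hker (show n ≤ S.e k by omega) _ h0
  have hx' : x = S.π ^ c • y + S.π ^ (S.e k - n) • v := by rw [← hv, add_sub_cancel]
  rw [hx', Submodule.ideal_span_singleton_smul]
  refine Submodule.add_mem _ (Submodule.smul_mem_pointwise_smul _ _ _ Submodule.mem_top) ?_
  rw [show S.e k - n = c + (S.e k - n - c) by omega, pow_add, mul_smul]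
  exact Submodule.smul_mem_pointwise_smul _ _ _ Submodule.mem_top

/-- Every exponent is reached by the levels: `i ≤ e_i` (`e` strictly increasing).
[cite: Howard2004HeegnerKolyvagin, §1.6 (arXiv p. 11, L33–36)] -/
theorem exists_le_e (S : DVRSetting p K R N Rk Nbar Nq) (hy : S.SatisfiesH) (i : ℕ) : ∃ k, i ≤ S.e k :=
  ⟨i, hy.e_strictMono.id_le i⟩

/-- **The host of `T/π^iT`**: the least level `k` with `i ≤ e_k` (so `T/π^iT = T^{(k)}/π^i T^{(k)}`).
[cite: Howard2004HeegnerKolyvagin, Def. 1.1.3 and §1.6 (arXiv p. 5 L93–99, p. 12 L29–55)] -/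
def host (S : DVRSetting p K R N Rk Nbar Nq) (hy : S.SatisfiesH) (i : ℕ) : ℕ := Nat.find (S.exists_le_e hy i)

/-- `i ≤ e (host i)`. [cite: Howard2004HeegnerKolyvagin, §1.6 (arXiv p. 12, L29–55)] -/
theorem le_e_host (S : DVRSetting p K R N Rk Nbar Nq) (hy : S.SatisfiesH) (i : ℕ) : i ≤ S.e (S.host hy i) :=
  Nat.find_spec (S.exists_le_e hy i)

/-- Minimality of the host: `i ≤ e_k ⇒ host i ≤ k`. [cite: Howard2004HeegnerKolyvagin, §1.6 (arXiv p. 12, L29–55)] -/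
theorem host_le_of_le_e (S : DVRSetting p K R N Rk Nbar Nq) (hy : S.SatisfiesH) {i k : ℕ} (h : i ≤ S.e k) :
    S.host hy i ≤ k :=
  Nat.find_min' _ h

/-- The host is monotone in the exponent. [cite: Howard2004HeegnerKolyvagin, §1.6 (arXiv p. 12, L29–55)] -/
theorem host_mono (S : DVRSetting p K R N Rk Nbar Nq) (hy : S.SatisfiesH) : Monotone (S.host hy) :=
  fun _ _ hij => S.host_le_of_le_e hy (hij.trans (S.le_e_host hy _))

/-- **The host of the exponent `e_k` is the level `k`** (the marked levels of the refinement).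
[cite: Howard2004HeegnerKolyvagin, §1.6 (arXiv p. 12, L29–55)] -/
theorem host_e (S : DVRSetting p K R N Rk Nbar Nq) (hy : S.SatisfiesH) (k : ℕ) : S.host hy (S.e k) = k :=
  le_antisymm (S.host_le_of_le_e hy le_rfl) (hy.e_strictMono.le_iff_le.mp (S.le_e_host hy (S.e k)))

/-! ## §3 The `π`-adic refinement datum of a `DVRSetting` -/

/-- **The `π`-adic refinement datum of the setting** (x10b-p1-w6's `PiRefinementDatum`): levels
`T^{(k)}`, two-index reductions `redLE`, `π`, exponents `e`, hosts `host`; the kernel and divisibility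
fields are §2.  Through it `PiRefinementDatum.Level i = T/π^iT` for EVERY `i`, with `levelRep`, `map`, `proj`,
`isQuotientBy_levelRep` (`Howard2004/PiAdicRefinement`).
[cite: Howard2004HeegnerKolyvagin, Def. 1.1.3 and §1.6 (arXiv p. 5 L93–99, p. 11 L33–36, p. 12 L29–55)] -/
def piRefinementDatum (S : DVRSetting p K R N Rk Nbar Nq) (hy : S.SatisfiesH) : PiRefinementDatum K R N where
  ρ := S.T.ρ
  hlin := S.T.hlin
  red _ _ h := S.T.redLE h
  red_equivariant _ _ h σ x := S.T.redLE_equivariant h σ x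
  red_refl k x := S.T.redLE_self k x
  red_trans _ _ _ h₁ h₂ x := S.T.redLE_trans h₁ h₂ x
  red_surjective _ _ h := S.T.redLE_surjective h
  π := S.π
  e := S.e
  e_mono := hy.e_strictMono.monotone
  ker_red k _ h := by rw [S.ker_redLE hy h, hy.unif, Ideal.span_singleton_pow]
  smul_mem_cancel k x c n hcn hx := S.smul_mem_cancel_level hy k x c n hcn hx
  host := S.host hy
  host_mono := S.host_mono hy
  le_e_host := S.le_e_host hy

/-- Unfolding: the levels of the datum are the `T^{(k)}`. [cite: Howard2004HeegnerKolyvagin, §1.6 (arXiv p. 12, L29–55)] -/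
@[simp] theorem piRefinementDatum_ρ (S : DVRSetting p K R N Rk Nbar Nq) (hy : S.SatisfiesH) :
    (S.piRefinementDatum hy).ρ = S.T.ρ := rfl

/-- Unfolding: the reductions of the datum are `redLE`. [cite: Howard2004HeegnerKolyvagin, §1.6 (arXiv p. 12, L29–55)] -/
@[simp] theorem piRefinementDatum_red (S : DVRSetting p K R N Rk Nbar Nq) (hy : S.SatisfiesH) {k k' : ℕ}
    (h : k ≤ k') (x : N k') : (S.piRefinementDatum hy).red h x = S.T.redLE h x := rfl

/-- Unfolding: `π`. [cite: Howard2004HeegnerKolyvagin, §1.6 (arXiv p. 11, L13–14)] -/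
@[simp] theorem piRefinementDatum_π (S : DVRSetting p K R N Rk Nbar Nq) (hy : S.SatisfiesH) :
    (S.piRefinementDatum hy).π = S.π := rfl

/-- Unfolding: `e`. [cite: Howard2004HeegnerKolyvagin, §1.6 (arXiv p. 11, L33–36)] -/
@[simp] theorem piRefinementDatum_e (S : DVRSetting p K R N Rk Nbar Nq) (hy : S.SatisfiesH) :
    (S.piRefinementDatum hy).e = S.e := rfl

/-- Unfolding: `host`. [cite: Howard2004HeegnerKolyvagin, §1.6 (arXiv p. 12, L29–55)] -/
@[simp] theorem piRefinementDatum_host (S : DVRSetting p K R N Rk Nbar Nq) (hy : S.SatisfiesH) :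
    (S.piRefinementDatum hy).host = S.host hy := rfl

/-- `𝔪^i` kills `T/π^iT`: an element of `𝔪^i = (π^i)` acts by zero on `Level i`.
[cite: Howard2004HeegnerKolyvagin, Def. 1.1.3 (arXiv p. 5 L93–99)] -/
theorem maximalIdeal_pow_smul_level_eq_zero (S : DVRSetting p K R N Rk Nbar Nq) (hy : S.SatisfiesH) (i : ℕ)
    (r : R) (hr : r ∈ IsLocalRing.maximalIdeal R ^ i) (x : (S.piRefinementDatum hy).Level i) : r • x = 0 := by
  rw [hy.unif, Ideal.span_singleton_pow, Ideal.mem_span_singleton'] at hr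
  obtain ⟨a, rfl⟩ := hr
  rw [mul_smul]
  exact (congrArg (a • ·) ((S.piRefinementDatum hy).pow_smul_level_eq_zero i x)).trans (smul_zero a)

/-! ## §4 The refined (full) tower `i ↦ T/π^{i+1}T` -/

/-- **The `π`-adically refined tower**: level `i` is `T/π^{i+1}T` (`Level (i+1)` of the datum, exponent
`i + 1`), with its quotient `Γ_K`-action and the reductions `T/π^{i+2} ↠ T/π^{i+1}` (`map (i+2) (i+1)`).  This is
Howard's own tower `T/𝔪^k T`, `k ≥ 1`. [cite: Howard2004HeegnerKolyvagin, §1.6 (arXiv p. 11 L33–36, p. 12 L29–55)] -/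
def refinedTower (S : DVRSetting p K R N Rk Nbar Nq) (hy : S.SatisfiesH) :
    AdicTower K R (fun i => (S.piRefinementDatum hy).Level (i + 1)) where
  ρ i := (S.piRefinementDatum hy).levelRep (i + 1)
  hlin i := (S.piRefinementDatum hy).isScalarLinear_levelRep (i + 1)
  killed i := ⟨i + 1, fun r hr x => S.maximalIdeal_pow_smul_level_eq_zero hy (i + 1) r hr x⟩
  red i := (S.piRefinementDatum hy).map (i + 1 + 1) (i + 1)
  red_surjective i := by
    have h := (S.piRefinementDatum hy).map_surjective 1 (i + 1)
    rwa [Nat.add_comm 1 (i + 1)] at h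
  red_equivariant i σ x := (S.piRefinementDatum hy).map_equivariant _ _ σ x

/-- Unfolding: the action on level `i` of the refined tower is `levelRep (i+1)`.
[cite: Howard2004HeegnerKolyvagin, §1.6 (arXiv p. 12, L29–55)] -/
@[simp] theorem refinedTower_ρ (S : DVRSetting p K R N Rk Nbar Nq) (hy : S.SatisfiesH) (i : ℕ) :
    (S.refinedTower hy).ρ i = (S.piRefinementDatum hy).levelRep (i + 1) := rfl

/-- Unfolding: the reduction of the refined tower is `map (i+2) (i+1)`.
[cite: Howard2004HeegnerKolyvagin, §1.6 (arXiv p. 12, L29–55)] -/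
@[simp] theorem refinedTower_red_apply (S : DVRSetting p K R N Rk Nbar Nq) (hy : S.SatisfiesH) (i : ℕ)
    (x : (S.piRefinementDatum hy).Level (i + 1 + 1)) :
    (S.refinedTower hy).red i x = (S.piRefinementDatum hy).map (i + 1 + 1) (i + 1) x := rfl

/-- **The iterated reductions of the refined tower are the maps `map`** of the datum:
`redIter j d = map (j+d+1) (j+1)` on `Level (j+d+1)`. [cite: Howard2004HeegnerKolyvagin, §1.6 (arXiv p. 12, L29–55)] -/
theorem refinedTower_redIter (S : DVRSetting p K R N Rk Nbar Nq) (hy : S.SatisfiesH) (j : ℕ) :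
    ∀ (d : ℕ) (x : (S.piRefinementDatum hy).Level (j + d + 1)),
      (S.refinedTower hy).redIter j d x = (S.piRefinementDatum hy).map (j + d + 1) (j + 1) x
  | 0, x => ((S.piRefinementDatum hy).map_self (j + 1) x).symm
  | d + 1, x => by
    rw [AdicTower.redIter_succ, refinedTower_redIter S hy j d, refinedTower_red_apply,
      (S.piRefinementDatum hy).map_map_of_le (by omega) (by omega)]
    rfl

/-- The two-index reductions of the refined tower are the maps `map`: `redLE (j ≤ j') = map (j'+1) (j+1)`.
[cite: Howard2004HeegnerKolyvagin, §1.6 (arXiv p. 12, L29–55)] -/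
theorem refinedTower_redLE (S : DVRSetting p K R N Rk Nbar Nq) (hy : S.SatisfiesH) {j j' : ℕ} (h : j ≤ j')
    (x : (S.piRefinementDatum hy).Level (j' + 1)) :
    (S.refinedTower hy).redLE h x = (S.piRefinementDatum hy).map (j' + 1) (j + 1) x := by
  induction j', h using Nat.le_induction with
  | base => rw [AdicTower.redLE_self, PiRefinementDatum.map_self]
  | succ j' h ih =>
    rw [AdicTower.redLE_succ _ h, ih, refinedTower_red_apply,
      (S.piRefinementDatum hy).map_map_of_le (by omega) (by omega)]

/-! ## §5 The marked levels: `T^{(k)} ≅ T/π^{e_k}T` -/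

/-- At an exponent `i = e_k` the host is `k`, so `proj : T^{(k)} → Level i` is available (`host i ≤ k`).
[cite: Howard2004HeegnerKolyvagin, §1.6 (arXiv p. 12, L29–55)] -/
theorem host_le_of_eq_e (S : DVRSetting p K R N Rk Nbar Nq) (hy : S.SatisfiesH) {i k : ℕ} (hi : i = S.e k) :
    (S.piRefinementDatum hy).host i ≤ k :=
  S.host_le_of_le_e hy hi.le

/-- **The marked levels: `proj : T^{(k)} → T/π^{e_k}T` is a BIJECTION** (`π^{e_k} T^{(k)} = 0`), stated for
any index `i` with `i = e_k` (so that the (COFINAL) marked index `σ k + 1` needs no cast) — the letter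
`hιb`. [cite: Howard2004HeegnerKolyvagin, §1.6 (arXiv p. 11 L33–36, p. 12 L29–55)] -/
theorem proj_bijective_of_eq_e (S : DVRSetting p K R N Rk Nbar Nq) (hy : S.SatisfiesH) {i k : ℕ}
    (hi : i = S.e k) : Bijective ((S.piRefinementDatum hy).proj (S.host_le_of_eq_e hy hi)) := by
  refine ⟨?_, (S.piRefinementDatum hy).proj_surjective _⟩
  rw [← LinearMap.ker_eq_bot, (S.piRefinementDatum hy).ker_proj, eq_bot_iff]
  refine Submodule.smul_le.mpr fun r hr x _ => ?_
  rw [piRefinementDatum_π, hi, ← Ideal.span_singleton_pow, ← hy.unif] at hr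
  exact hy.killed k r hr x

/-- The marked-level maps are `Γ_K`-equivariant — the letter `hιe`. [cite: Howard2004HeegnerKolyvagin, §1.6 (arXiv p. 12, L29–55)] -/
theorem proj_equivariant (S : DVRSetting p K R N Rk Nbar Nq) (hy : S.SatisfiesH) {i k : ℕ}
    (h : (S.piRefinementDatum hy).host i ≤ k) (g : absoluteGaloisGroup K) (x : N k) :
    (S.piRefinementDatum hy).proj h (S.T.ρ k g x) =
      (S.piRefinementDatum hy).levelRep i g ((S.piRefinementDatum hy).proj h x) :=
  ((S.piRefinementDatum hy).isQuotientBy_levelRep h).equivariant g x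

/-- **RED-compatibility of the marked levels**: `proj_i (red_k y) = map i' i (proj_{i'} y)` for the hosted
indices `i` (on `k`) and `i' ≥ i` (on `k+1`) — with `i = e_k`, `i' = e_{k+1}` this is the letter `hιred` (the
reductions of the refined tower between marked levels are `map`, `refinedTower_redIter`).
[cite: Howard2004HeegnerKolyvagin, §1.6 (arXiv p. 12, L29–55)] -/
theorem proj_red_eq_map_proj (S : DVRSetting p K R N Rk Nbar Nq) (hy : S.SatisfiesH) {i i' k : ℕ}
    (hii' : i ≤ i') (h : (S.piRefinementDatum hy).host i ≤ k) (h' : (S.piRefinementDatum hy).host i' ≤ k + 1)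
    (y : N (k + 1)) :
    (S.piRefinementDatum hy).proj h (S.T.red k y) =
      (S.piRefinementDatum hy).map i' i ((S.piRefinementDatum hy).proj h' y) := by
  have e1 : S.T.red k y = (S.piRefinementDatum hy).red (Nat.le_succ k) y := by
    rw [piRefinementDatum_red, AdicTower.redLE_succ_self]
  rw [e1, (S.piRefinementDatum hy).proj_red h (Nat.le_succ k),
    (S.piRefinementDatum hy).map_proj i' i h' (h.trans (Nat.le_succ k)), Nat.sub_eq_zero_of_le hii',
    pow_zero, one_smul]

/-- The same with the iterated reductions of the refined tower: for marked indices `i + 1` (hosted on `k`) and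
`i + d + 1` (hosted on `k + 1`), `proj (red_k y) = redIter i d (proj y)` — the letter `hιred` verbatim for
`σ (k+1) = σ k + d`. [cite: Howard2004HeegnerKolyvagin, §1.6 (arXiv p. 12, L29–55)] -/
theorem proj_red_eq_redIter_proj (S : DVRSetting p K R N Rk Nbar Nq) (hy : S.SatisfiesH) {i d k : ℕ}
    (h : (S.piRefinementDatum hy).host (i + 1) ≤ k) (h' : (S.piRefinementDatum hy).host (i + d + 1) ≤ k + 1)
    (y : N (k + 1)) :
    (S.piRefinementDatum hy).proj h (S.T.red k y) =
      (S.refinedTower hy).redIter i d ((S.piRefinementDatum hy).proj h' y) := by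
  rw [refinedTower_redIter, S.proj_red_eq_map_proj hy (by omega) h h']

end DVRSetting

end Literature.NumberTheory.GaloisCohomology.Howard2004

end
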